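import Literature.Geometry.Riemannian.DirichletEnergyEstimates
import HarnessLib

/-!
# Minimising the Dirichlet energy of `χ - v` over `v ∈ C_c^∞` under a Sobolev inequality:
# the `L^{2p/(p-2)}` limit (Carron 2007, Prop. 2.11 / Remark 2.6)

Fifth layer (analysis, part B) of the proof programme of
`Literature.Geometry.Riemannian.Carron1998_ends_le_rank_l2HarmonicOneForms`
(`L2HarmonicOneFormsSobolev.lean`). G. Carron, *L² harmonic forms on non-compact Riemannian
manifolds*, arXiv:0704.3194 (2007): the `L²`-limit of exact forms `df_k`, `f_k ∈ C_c^∞`, is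
controlled by the Sobolev inequality — "Since we have the inequality
`‖df_k - df_l‖²_{L²} ≥ λ ‖f_k - f_l‖²_{L²}` … we conclude that this sequence `(f_k)` converges to
some `f`" (proof of Prop. 2.4), "we find `f ∈ L^{2ν/(ν-2)}` such that `α = df`" (proof of
Prop. 2.11) — and the harmonic representative is a minimiser of `u ↦ ∫ |du|²` (Remark 2.6).
For a Riemannian manifold `(X, h)` (boundaryless real model with corners, smooth Mathlib metric)
satisfying the tree's `HasSobolevInequality h p μ` (`p > 2`, `μ > 0`) and a smooth `χ` whose
differential vanishes off a compact set, this file PROVES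

* `exists_dirichlet_minimising_limit` — **a minimising sequence and its `L^q` limit**: there are
  the infimum `m` of the energies `E(v) = ∫ |d(χ - v)|²_h` over `v ∈ C_c^∞(X)`, a sequence
  `vₙ ∈ C_c^∞(X)` with `E(vₙ) → m`, and a function `w ∈ L^q(X, dV_h)`, `q = 2p/(p-2)`, with
  `‖vₙ - w‖_{L^q} → 0`; moreover the first variation vanishes in the limit,
  `∫ h⁻¹(d(χ - vₙ), dζ) → 0` for every `ζ ∈ C_c^∞(X)`.
  (Parallelogram identity ⇒ `∫ |d(vₙ - v_k)|² → 0`; the Sobolev inequality in `L^q` form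
  `μ ‖·‖²_q ≤ ∫ |d·|²` ⇒ `(vₙ)` is Cauchy in `L^q`, which is complete
  (Mathlib's `cauchy_complete_eLpNorm`, along a subsequence with geometric rate); the first
  variation inequality `(∫ h⁻¹(d(χ-vₙ), dζ))² ≤ (E(vₙ) - m) ∫|dζ|²`.)

Everything is proved; no definitions, no named facts (D-0026).

## References

* G. Carron, *L² harmonic forms on non-compact Riemannian manifolds*, arXiv:0704.3194 (2007),
  proofs of Prop. 2.4 and Prop. 2.11, Remark 2.6. [`Carron2007`]
-/

noncomputable section

open Bundle Set Function Filter Topology MeasureTheory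
open scoped Manifold ContDiff ENNReal NNReal

namespace Literature.Geometry.Riemannian

open Literature.Geometry.Lorentzian
open Literature.Geometry.Lorentzian.PseudoRiemannianMetric

variable {E : Type*} [NormedAddCommGroup E] [NormedSpace ℝ E] [FiniteDimensional ℝ E]
  {H : Type*} [TopologicalSpace H] {I : ModelWithCorners ℝ E H} [I.Boundaryless]
  {X : Type*} [TopologicalSpace X] [ChartedSpace H X] [IsManifold I ∞ X]
  [T3Space X] [MeasurableSpace X] [BorelSpace X]
  (h : ContMDiffRiemannianMetric I ∞ E (TangentSpace I : X → Type _))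

/-- From a qualitative Cauchy property to a geometric rate along a subsequence: if for every `j`
there is `N` beyond which `d (v n) (v m) < (1/2)^j`, then along some `ψ : ℕ → ℕ` with `j ≤ ψ j`
we have `d (v (ψ j)) (v (ψ l)) < (1/2)^J` for all `J ≤ j, l`. [folklore] -/
theorem exists_subseq_rate {d : ℕ → ℕ → ℝ≥0∞}
    (hcau : ∀ j : ℕ, ∃ N : ℕ, ∀ n m : ℕ, N ≤ n → N ≤ m → d n m < (2⁻¹ : ℝ≥0∞) ^ j) :
    ∃ ψ : ℕ → ℕ, (∀ j, j ≤ ψ j) ∧ ∀ J j l : ℕ, J ≤ j → J ≤ l → d (ψ j) (ψ l) < (2⁻¹ : ℝ≥0∞) ^ J := by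
  choose N hN using hcau
  refine ⟨fun j ↦ j + ∑ i ∈ Finset.range (j + 1), N i, fun j ↦ Nat.le_add_right _ _,
    fun J j l hJj hJl ↦ hN J _ _ ?_ ?_⟩
  · have : N J ≤ ∑ i ∈ Finset.range (j + 1), N i :=
      Finset.single_le_sum (fun i _ ↦ Nat.zero_le (N i)) (Finset.mem_range.2 (by omega))
    show N J ≤ j + ∑ i ∈ Finset.range (j + 1), N i
    omega
  · have : N J ≤ ∑ i ∈ Finset.range (l + 1), N i :=
      Finset.single_le_sum (fun i _ ↦ Nat.zero_le (N i)) (Finset.mem_range.2 (by omega))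
    show N J ≤ l + ∑ i ∈ Finset.range (l + 1), N i
    omega

/-- **A minimising sequence for the Dirichlet energy and its `L^{2p/(p-2)}` limit** (Carron 2007,
proofs of Prop. 2.4/2.11 and Remark 2.6, in the variational form followed by this tree). Let
`(X, h)` satisfy the Sobolev inequality `(S_p)` with constant `μ > 0`, `p > 2`, and let `χ` be
smooth with `dχ = 0` off a compact set `K₁`. Then there are: the infimum `m` of
`E(v) = ∫ |d(χ - v)|²_h dV_h` over `v ∈ C_c^∞(X)` (`m ≤ E(v)` for all such `v`), a sequence
`vₙ ∈ C_c^∞(X)` with `E(vₙ) → m`, and `w ∈ L^q(dV_h)`, `q = 2p/(p-2)`, with `‖vₙ - w‖_{L^q} → 0`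
and `∫ h⁻¹(d(χ - vₙ), dζ) dV_h → 0` for every `ζ ∈ C_c^∞(X)`.
[cite: Carron2007, Prop. 2.11 (proof) and Remark 2.6] -/
theorem exists_dirichlet_minimising_limit {p μ : ℝ} (hp : 2 < p) (hμ : 0 < μ)
    (hS : HasSobolevInequality h p μ) {χ : X → ℝ} (hχ : ContMDiff I 𝓘(ℝ, ℝ) ∞ χ) {K₁ : Set X}
    (hK₁ : IsCompact K₁) (hχK : ∀ x ∉ K₁, mvfderiv I χ x = 0) :
    ∃ (m : ℝ) (v : ℕ → X → ℝ) (w : X → ℝ),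
      (∀ n, ContMDiff I 𝓘(ℝ, ℝ) ∞ (v n)) ∧ (∀ n, HasCompactSupport (v n)) ∧
      (∀ u : X → ℝ, ContMDiff I 𝓘(ℝ, ℝ) ∞ u → HasCompactSupport u →
        m ≤ ∫ x, (PseudoRiemannianMetric.ofRiemannian h).gradSq (χ - u) x ∂riemannianMeasure h) ∧
      Tendsto (fun n ↦ ∫ x, (PseudoRiemannianMetric.ofRiemannian h).gradSq (χ - v n) x
        ∂riemannianMeasure h) atTop (𝓝 m) ∧
      MemLp w (ENNReal.ofReal (2 * p / (p - 2))) (riemannianMeasure h) ∧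
      Tendsto (fun n ↦ eLpNorm (v n - w) (ENNReal.ofReal (2 * p / (p - 2))) (riemannianMeasure h))
        atTop (𝓝 0) ∧
      ∀ ζ : X → ℝ, ContMDiff I 𝓘(ℝ, ℝ) ∞ ζ → HasCompactSupport ζ →
        Tendsto (fun n ↦ ∫ x, (PseudoRiemannianMetric.ofRiemannian h).innerDual x
          (mvfderiv I (χ - v n) x).toLinearMap (mvfderiv I ζ x).toLinearMap ∂riemannianMeasure h)
          atTop (𝓝 0) := by
  haveI : IsFiniteMeasureOnCompacts (riemannianMeasure h) :=
    ⟨fun K hK ↦ riemannianVolume_lt_top_of_isCompact_holds h le_rfl hK⟩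
  set g := PseudoRiemannianMetric.ofRiemannian h with hgdef
  set ν : Measure X := riemannianMeasure h with hν
  set q : ℝ≥0∞ := ENNReal.ofReal (2 * p / (p - 2)) with hq
  have hp2 : 0 < p - 2 := by linarith
  have hq1 : 1 ≤ q := by
    rw [hq, ← ENNReal.ofReal_one]
    refine ENNReal.ofReal_le_ofReal ?_
    rw [le_div_iff₀ hp2]; linarith
  -- the energy functional on test functions
  set En : (X → ℝ) → ℝ := fun u ↦ ∫ x, g.gradSq (χ - u) x ∂ν with hEn
  have hEn_nonneg : ∀ u, 0 ≤ En u := fun u ↦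
    integral_nonneg fun x ↦ innerDual_self_nonneg (h := h) x _
  -- the infimum `m`
  set S : Set ℝ := {e | ∃ u : X → ℝ, ContMDiff I 𝓘(ℝ, ℝ) ∞ u ∧ HasCompactSupport u ∧ En u = e}
    with hSdef
  have hSne : S.Nonempty := ⟨En 0, 0, contMDiff_const, HasCompactSupport.zero, rfl⟩
  have hSbdd : BddBelow S := ⟨0, fun e ⟨u, _, _, he⟩ ↦ he ▸ hEn_nonneg u⟩
  set m : ℝ := sInf S with hm
  have hmle : ∀ u : X → ℝ, ContMDiff I 𝓘(ℝ, ℝ) ∞ u → HasCompactSupport u → m ≤ En u :=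
    fun u hu huc ↦ csInf_le hSbdd ⟨u, hu, huc, rfl⟩
  -- a minimising sequence
  obtain ⟨e, -, he, heS⟩ := exists_seq_tendsto_sInf hSne hSbdd
  choose v₀ hv₀s hv₀c hv₀e using heS
  have hEv₀ : Tendsto (fun n ↦ En (v₀ n)) atTop (𝓝 m) := by
    simp only [hv₀e]; exact he
  -- energies of differences tend to zero (parallelogram identity)
  have hdiff : ∀ ε : ℝ, 0 < ε → ∃ N : ℕ, ∀ n k : ℕ, N ≤ n → N ≤ k →
      ∫ x, g.gradSq (v₀ n - v₀ k) x ∂ν < ε := by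
    intro ε hε
    have hev : ∀ᶠ n in atTop, En (v₀ n) < m + ε / 4 :=
      (tendsto_order.1 hEv₀).2 _ (by linarith)
    obtain ⟨N, hN⟩ := eventually_atTop.1 hev
    refine ⟨N, fun n k hn hk ↦ ?_⟩
    have hpar := integral_gradSq_sub_sub_parallelogram h hχ hK₁ hχK (hv₀s n) (hv₀c n) (hv₀s k) (hv₀c k)
    have hmid : m ≤ En (fun y ↦ (1 / 2 : ℝ) * (v₀ n y + v₀ k y)) :=
      hmle _ (contMDiff_const.mul ((hv₀s n).add (hv₀s k))) (((hv₀c n).add (hv₀c k)).mul_left)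
    have h1 := hN n hn
    have h2 := hN k hk
    change ∫ x, g.gradSq (v₀ n - v₀ k) x ∂ν = 2 * En (v₀ n) + 2 * En (v₀ k) -
      4 * En (fun y ↦ (1 / 2 : ℝ) * (v₀ n y + v₀ k y)) at hpar
    linarith
  -- the `L^q` Cauchy property from the Sobolev inequality
  have hLq : ∀ n k : ℕ, eLpNorm (v₀ n - v₀ k) q ν ^ (2 : ℝ) ≤
      ENNReal.ofReal (μ⁻¹ * ∫ x, g.gradSq (v₀ n - v₀ k) x ∂ν) := by
    intro n k
    have hsob := ofReal_mul_eLpNorm_sq_le_lintegral_gradSq h hp hS ((hv₀s n).sub (hv₀s k))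
      ((hv₀c n).sub (hv₀c k))
    obtain ⟨-, -, hI⟩ := integrable_gradSq_sub h (contMDiff_const (c := (0 : ℝ))) isCompact_empty
      (fun x _ ↦ mvfderiv_const (I := I) (0 : ℝ)) ((hv₀s k).sub (hv₀s n)) ((hv₀c k).sub (hv₀c n))
    have heq : ((fun _ ↦ (0 : ℝ)) - fun x ↦ v₀ k x - v₀ n x) = fun x ↦ v₀ n x - v₀ k x := by
      funext y; simp
    rw [heq] at hI
    rw [← ofReal_integral_eq_lintegral_ofReal hI (Eventually.of_forall fun x ↦
      innerDual_self_nonneg (h := h) x _)] at hsob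
    rw [ENNReal.ofReal_mul (inv_nonneg.2 hμ.le), ENNReal.ofReal_inv_of_pos hμ]
    calc eLpNorm (v₀ n - v₀ k) q ν ^ (2 : ℝ)
        = (ENNReal.ofReal μ)⁻¹ * (ENNReal.ofReal μ * eLpNorm (v₀ n - v₀ k) q ν ^ (2 : ℝ)) := by
          rw [← mul_assoc, ENNReal.inv_mul_cancel (ENNReal.ofReal_pos.2 hμ).ne' ENNReal.ofReal_ne_top,
            one_mul]
      _ ≤ (ENNReal.ofReal μ)⁻¹ * ENNReal.ofReal (∫ x, g.gradSq (v₀ n - v₀ k) x ∂ν) :=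
          mul_le_mul' le_rfl hsob
  have hcau : ∀ j : ℕ, ∃ N : ℕ, ∀ n k : ℕ, N ≤ n → N ≤ k →
      eLpNorm (v₀ n - v₀ k) q ν < (2⁻¹ : ℝ≥0∞) ^ j := by
    intro j
    -- choose `ε` with `μ⁻¹ ε < ((1/2)^j)²`
    set δ : ℝ := ((1 / 2 : ℝ) ^ j) ^ 2 with hδ
    have hδpos : 0 < δ := by positivity
    obtain ⟨N, hN⟩ := hdiff (μ * δ / 2) (by positivity)
    refine ⟨N, fun n k hn hk ↦ ?_⟩
    have h1 := hLq n k
    have h2 : μ⁻¹ * ∫ x, g.gradSq (v₀ n - v₀ k) x ∂ν < δ := by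
      have := hN n k hn hk
      calc μ⁻¹ * ∫ x, g.gradSq (v₀ n - v₀ k) x ∂ν < μ⁻¹ * (μ * δ / 2) :=
            mul_lt_mul_of_pos_left this (inv_pos.2 hμ)
        _ = δ / 2 := by field_simp
        _ < δ := by linarith
    have h3 : eLpNorm (v₀ n - v₀ k) q ν ^ (2 : ℝ) < ENNReal.ofReal δ :=
      lt_of_le_of_lt h1 ((ENNReal.ofReal_lt_ofReal_iff hδpos).2 h2)
    -- take square roots
    have h4 : eLpNorm (v₀ n - v₀ k) q ν < ENNReal.ofReal δ ^ (1 / 2 : ℝ) := by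
      have := ENNReal.rpow_lt_rpow h3 (by norm_num : (0 : ℝ) < 1 / 2)
      rwa [← ENNReal.rpow_mul, show (2 : ℝ) * (1 / 2) = 1 by norm_num, ENNReal.rpow_one] at this
    refine h4.trans_eq ?_
    rw [hδ, ENNReal.ofReal_pow (by positivity), ← ENNReal.rpow_natCast, ← ENNReal.rpow_mul,
      show ((2 : ℕ) : ℝ) * (1 / 2) = 1 by norm_num, ENNReal.rpow_one,
      ENNReal.ofReal_pow (by positivity), ENNReal.ofReal_div_of_pos two_pos, ENNReal.ofReal_one,
      ENNReal.ofReal_ofNat, one_div]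
  -- pass to a subsequence with geometric rate and take the `L^q` limit
  obtain ⟨ψ, hψge, hψ⟩ := exists_subseq_rate hcau
  set v : ℕ → X → ℝ := fun j ↦ v₀ (ψ j) with hvdef
  have hvmem : ∀ j, MemLp (v j) q ν := fun j ↦
    (hv₀s (ψ j)).continuous.memLp_of_hasCompactSupport (hv₀c (ψ j))
  have hB : ∑' J : ℕ, (2⁻¹ : ℝ≥0∞) ^ J ≠ ⊤ := by
    rw [ENNReal.tsum_geometric]
    simp
  obtain ⟨w, hwmem, hwlim⟩ := MeasureTheory.Lp.cauchy_complete_eLpNorm (μ := ν) hq1 hvmem hB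
    (fun J j l hJj hJl ↦ hψ J j l hJj hJl)
  have hψtop : Tendsto ψ atTop atTop := tendsto_atTop_mono hψge tendsto_id
  refine ⟨m, v, w, fun j ↦ hv₀s _, fun j ↦ hv₀c _, hmle, hEv₀.comp hψtop, hwmem, hwlim, ?_⟩
  -- the first variation vanishes in the limit
  intro ζ hζ hζc
  set C : ℝ := ∫ x, g.gradSq ζ x ∂ν with hC
  have hC0 : 0 ≤ C := integral_nonneg fun x ↦ innerDual_self_nonneg (h := h) x _
  have hbound : ∀ j, |∫ x, g.innerDual x (mvfderiv I (χ - v j) x).toLinearMap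
      (mvfderiv I ζ x).toLinearMap ∂ν| ≤ Real.sqrt ((En (v j) - m) * C) := by
    intro j
    have hsq := sq_integral_innerDual_le_of_forall_le h hχ hK₁ hχK (hv₀s (ψ j)) (hv₀c (ψ j)) hζ hζc
      (m := m) hmle
    rw [← Real.sqrt_sq (abs_nonneg _), sq_abs]
    exact Real.sqrt_le_sqrt hsq
  have hlim : Tendsto (fun j ↦ Real.sqrt ((En (v j) - m) * C)) atTop (𝓝 0) := by
    have h1 : Tendsto (fun j ↦ (En (v j) - m) * C) atTop (𝓝 ((m - m) * C)) :=
      (((hEv₀.comp hψtop).sub tendsto_const_nhds).mul tendsto_const_nhds)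
    rw [sub_self, zero_mul] at h1
    have h2 := (Real.continuous_sqrt.tendsto 0).comp h1
    rwa [Function.comp_def, Real.sqrt_zero] at h2
  exact squeeze_zero_norm (fun j ↦ by rw [Real.norm_eq_abs]; exact hbound j) hlim

end Literature.Geometry.Riemannian

end
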